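import Summits.NavierStokesRegularity.NavierStokesRegularity.Theorems.ClockStretchingLawClockLaw
import HarnessLib

/-!
# Route `ClockStretchingLaw`, crux `ClockCeiling` (stmt-NavierStokesRegularity-10570): the CLASS-UNIFORM,
# ALL-TIME clock law — portrait of a counterexample

Line `registered` of the crux, lead c2 (2026-08-17), `--supports` file. By the typed certificates of
this line (`ClockStretchingLawClockCeilingIffTarget.lean`, `…LiouvilleNode.lean`) the crux is the Type-I
Liouville node, so its only counterexamples are the Type-I singularity models: elements of the route's
class `𝒦_C` (smooth, divergence-free, KNSS-mild ancient fields with `‖u‖ ≤ C/√(−t)` and the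
scale-invariant energy ledger `A, E ≤ C`) that are unbounded in every backward cylinder at the origin.
The proved crux `ClockLaw` gives each such element its own floor `a_u ≥ δ(u) > 0` on `[−1,0)`. This file
upgrades it to a floor that is UNIFORM IN THE ELEMENT and holds AT EVERY NEGATIVE TIME:

* `clockLaw_singular_of_limit` — persistence of the singularity along ARBITRARY sequences of singular
  elements of `𝒦_C` converging pointwise on the open slab (Albritton–Barker Lemma 2.2 + Prop. 2.3
  through the tree's `unbounded_at_origin_of_zoomIn_limit`, fed with the class pressure
  `classPressure_holds` and `limitSingular_eLpNorm_top_eq_top`);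
* `clockLaw_singular_zoom` — the zooms of a singular element are singular;
* `clockLaw_uniform_at_neg_one` — `∃ δ(C) > 0`: every singular element of `𝒦_C` has `a_u(−1) ≥ δ(C)`
  (compactness of the class on growing windows, `exists_tendsto_of_typeI_seq_Ioo` +
  `energyBounds_of_tendsto_Ioo`; persistence; convergence of the amplitudes `stub_clockSlice` (iii);
  positivity of the clock of a singular element `clockLaw_amp_pos`);
* `stub_uniformClockLaw` — by the zoom covariance `a_{u_c}(−1) = a_u(−c²)` (`stub_clockSlice` (iv)):
  **for every `C` there is `δ(C) > 0` such that every singular element of `𝒦_C` satisfies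
  `a_u(t) ≥ δ(C)` for ALL `t < 0`.**

In similarity variables `U(s,y) = √(−t) u(t, √(−t) y)`, `s = −log(−t)`, the clock mode is
`W = (−t)^{3/2} ∂ₜu = ΔU − U·∇U − ∇P` (the steady Navier–Stokes residual of the Leray profile) and
`a_u(t) = ‖W(s)‖²_{L²(e^{−|y|²/4})}`; so the portrait clause reads: the Leray profile of a Type-I
singularity model stays, at EVERY similarity time, at `L²_ρ`-distance `≥ √δ(C)` from solving the steady
Navier–Stokes equations — a quantitative, class-uniform sharpening of Tsai's theorem (self-similar
profiles, whose residual vanishes identically, are trivial) in the clock metric.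

## References

* D. Albritton, T. Barker, J. Math. Fluid Mech. 21 (2019) = arXiv:1811.00502, Lemma 2.2, Prop. 2.3, §3.
  [AlbrittonBarker2019]
* G. Koch, N. Nadirashvili, G. Seregin, V. Šverák, Acta Math. 203 (2009) = arXiv:0709.3599, Lemma 6.1,
  Prop. 4.1. [KochNadirashviliSereginSverak2009]
* T.-P. Tsai, Arch. Ration. Mech. Anal. 143 (1998), Thm 1. [Tsai1998]
-/

noncomputable section

open MeasureTheory Filter Topology Set Metric Function
open scoped NNReal ENNReal

-- `Summit = Problem` namespace duplication is the tree's layout (CONVENTIONS §1); as in every Theorems file.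
set_option linter.dupNamespace false

namespace Summit.NavierStokesRegularity.NavierStokesRegularity.Theorems

open Literature.Analysis Literature.Analysis.FluidPDE
open Summit.NavierStokesRegularity.NavierStokesRegularity.Theorems.ClockLaw.Birth

/-! ### Persistence of the singularity along sequences of singular class elements -/

/-- **Persistence of the singularity along sequences in the class.** If `w n ∈ 𝒦_C` (Type-I KNSS-mild
with the energy ledger `A, E ≤ C`) are all unbounded in every backward cylinder at the origin and
converge pointwise on the open slab `t < 0` to a field `W`, then `W` is unbounded in every backward
cylinder at the origin. (Each `w n` is, with the class pressure of `classPressure_holds`, a suitable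
weak solution in `Q(0,1)` with `‖w n‖_{L³} + ‖p n‖_{L^{3/2}} ≤ 2K(C)`, essentially unbounded on every
`Q(0,R')`; Albritton–Barker's compactness and persistence do the rest,
`unbounded_at_origin_of_zoomIn_limit`.) [cite: AlbrittonBarker2019, Lemma 2.2 and Prop. 2.3] -/
theorem clockLaw_singular_of_limit {C : ℝ}
    {w : ℕ → ℝ → EuclideanSpace ℝ (Fin 3) → EuclideanSpace ℝ (Fin 3)}
    {W : ℝ → EuclideanSpace ℝ (Fin 3) → EuclideanSpace ℝ (Fin 3)}
    (hw : ∀ n, IsTypeIAncientMild C (w n))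
    (hE : ∀ n, ∀ (x₀ : EuclideanSpace ℝ (Fin 3)) (t₀ r : ℝ), t₀ ≤ 0 → 0 < r →
      (∀ t, t₀ - r ^ 2 < t → t < t₀ → r⁻¹ * ∫ x in Metric.ball x₀ r, ‖w n t x‖ ^ 2 ≤ C) ∧
        r⁻¹ * ∫ t in Set.Ioo (t₀ - r ^ 2) t₀, ∫ x in Metric.ball x₀ r, ‖fderiv ℝ (w n t) x‖ ^ 2 ≤ C)
    (hsing : ∀ n, ∀ r > 0, ∀ M : ℝ, ∃ t ∈ Set.Ioo (-(r ^ 2)) (0 : ℝ),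
      ∃ x ∈ Metric.ball (0 : EuclideanSpace ℝ (Fin 3)) r, M < ‖w n t x‖)
    (hpt : ∀ t < 0, ∀ x, Tendsto (fun n => w n t x) atTop (𝓝 (W t x))) :
    ∀ r > 0, ∀ M : ℝ, ∃ t ∈ Set.Ioo (-(r ^ 2)) (0 : ℝ),
      ∃ x ∈ Metric.ball (0 : EuclideanSpace ℝ (Fin 3)) r, M < ‖W t x‖ := by
  obtain ⟨K, hK⟩ := classPressure_holds C
  have hP' : ∀ n, ∃ p : ℝ → EuclideanSpace ℝ (Fin 3) → ℝ,
      IsSuitableWeakSolutionInBall 1 0 (w n) p ∧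
        eLpNorm (Function.uncurry (w n)) 3
            (volume.restrict (parabolicCylinder 1 (0 : ℝ × EuclideanSpace ℝ (Fin 3)))) ≤ K ∧
        eLpNorm (Function.uncurry p) (3 / 2)
            (volume.restrict (parabolicCylinder 1 (0 : ℝ × EuclideanSpace ℝ (Fin 3)))) ≤ K :=
    fun n => hK _ (hw n) (hE n)
  choose P hP using hP'
  refine unbounded_at_origin_of_zoomIn_limit (W := w) (P := P) (fun n => (hP n).1) ?_
    (fun n R' hR' => ?_) ?_
  · -- the uniform `L³ × L^{3/2}` bound `≤ K + K < ∞`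
    refine lt_of_le_of_lt (iSup_le fun n => add_le_add (hP n).2.1 (hP n).2.2) ?_
    exact ENNReal.add_lt_top.2 ⟨ENNReal.coe_lt_top, ENNReal.coe_lt_top⟩
  · -- each element is essentially unbounded on every `Q(0, R')`
    exact limitSingular_eLpNorm_top_eq_top (hw n).continuousOn_uncurry (hsing n) hR'.1
  · -- pointwise convergence on `Q(0, 1/2) ⊆ {t < 0}`
    rintro ⟨t, x⟩ hz
    rw [SuitableCompactness.mem_parabolicCylinder_zero] at hz
    exact hpt t hz.1.2 x

/-! ### Zooms of a singular element are singular -/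

/-- **The Navier–Stokes zoom about the origin preserves the singularity**: if `u` is unbounded in every
backward cylinder `Q(0,r)`, so is `u_c = c • stPull (c²) c 0 0 u`, `(t,x) ↦ c u(c²t, cx)`, for every
`c > 0` (`Q(0,r)` for `u_c` is `Q(0,cr)` for `u`, and `‖u_c‖ = c‖u‖`). [folklore] -/
theorem clockLaw_singular_zoom {u : ℝ → EuclideanSpace ℝ (Fin 3) → EuclideanSpace ℝ (Fin 3)}
    (hsing : ∀ r > 0, ∀ M : ℝ, ∃ t ∈ Set.Ioo (-(r ^ 2)) (0 : ℝ),
      ∃ x ∈ Metric.ball (0 : EuclideanSpace ℝ (Fin 3)) r, M < ‖u t x‖)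
    {c : ℝ} (hc : 0 < c) :
    ∀ r > 0, ∀ M : ℝ, ∃ t ∈ Set.Ioo (-(r ^ 2)) (0 : ℝ),
      ∃ x ∈ Metric.ball (0 : EuclideanSpace ℝ (Fin 3)) r, M < ‖(c • stPull (c ^ 2) c 0 0 u) t x‖ := by
  intro r hr M
  have hc2 : 0 < c ^ 2 := by positivity
  obtain ⟨t, ht, x, hx, hM⟩ := hsing (c * r) (mul_pos hc hr) (M / c)
  refine ⟨t / c ^ 2, ⟨?_, div_neg_of_neg_of_pos ht.2 hc2⟩, c⁻¹ • x, ?_, ?_⟩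
  · rw [lt_div_iff₀ hc2]
    have h1 : -((c * r) ^ 2) < t := ht.1
    nlinarith
  · rw [Metric.mem_ball, dist_zero_right, norm_smul, Real.norm_of_nonneg (inv_pos.2 hc).le]
    rw [Metric.mem_ball, dist_zero_right] at hx
    calc c⁻¹ * ‖x‖ < c⁻¹ * (c * r) := mul_lt_mul_of_pos_left hx (inv_pos.2 hc)
      _ = r := by field_simp
  · have hval : (c • stPull (c ^ 2) c 0 0 u) (t / c ^ 2) (c⁻¹ • x) = c • u t x := by
      simp only [Pi.smul_apply, stPull_apply, zero_add, smul_smul, mul_inv_cancel₀ hc.ne', one_smul,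
        mul_div_cancel₀ _ hc2.ne']
    rw [hval, norm_smul, Real.norm_of_nonneg hc.le]
    rwa [div_lt_iff₀' hc] at hM

/-! ### The class-uniform clock law at `t = -1` -/

/-- **Uniform clock floor at `t = −1`.** For every `C` there is `δ > 0` such that every element of `𝒦_C`
that is singular at the space-time origin has `a_u(−1) ≥ δ`. Otherwise singular `u_n ∈ 𝒦_C` with
`a_{u_n}(−1) → 0` subconverge on the open slab (KNSS compactness on growing windows,
`exists_tendsto_of_typeI_seq_Ioo`; the ledger passes, `energyBounds_of_tendsto_Ioo`) to a singular
element `W` (`clockLaw_singular_of_limit`) with `a_W(−1) = lim a_{u_n}(−1) = 0` (`stub_clockSlice` (iii)),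
contradicting the positivity of the clock of a singular element (`clockLaw_amp_pos`).
[cite: AlbrittonBarker2019, Lemma 2.2 and Prop. 2.3] [cite: KochNadirashviliSereginSverak2009, Lemma 6.1 and Prop. 4.1 (arXiv:0709.3599 pp. 8, 11)] -/
theorem clockLaw_uniform_at_neg_one (C : ℝ) :
    ∃ δ > 0, ∀ u : ℝ → EuclideanSpace ℝ (Fin 3) → EuclideanSpace ℝ (Fin 3), IsTypeIAncientMild C u →
      (∀ (x₀ : EuclideanSpace ℝ (Fin 3)) (t₀ r : ℝ), t₀ ≤ 0 → 0 < r →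
        (∀ t, t₀ - r ^ 2 < t → t < t₀ → r⁻¹ * ∫ x in Metric.ball x₀ r, ‖u t x‖ ^ 2 ≤ C) ∧
          r⁻¹ * ∫ t in Set.Ioo (t₀ - r ^ 2) t₀, ∫ x in Metric.ball x₀ r, ‖fderiv ℝ (u t) x‖ ^ 2 ≤ C) →
      (∀ r > 0, ∀ M : ℝ, ∃ t ∈ Set.Ioo (-(r ^ 2)) (0 : ℝ),
        ∃ x ∈ Metric.ball (0 : EuclideanSpace ℝ (Fin 3)) r, M < ‖u t x‖) →
      δ ≤ (-(-1 : ℝ)) ^ ((3 : ℝ) / 2) *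
        ∫ x, ‖timeDeriv u (-1) x‖ ^ 2 * Real.exp (-(‖x‖ ^ 2) / (4 * (-(-1 : ℝ)))) := by
  by_contra h
  push Not at h
  -- a sequence of singular elements whose clock at `-1` reads `< 1/(n+1)`
  have hseq : ∀ n : ℕ, ∃ u : ℝ → EuclideanSpace ℝ (Fin 3) → EuclideanSpace ℝ (Fin 3),
      IsTypeIAncientMild C u ∧
      (∀ (x₀ : EuclideanSpace ℝ (Fin 3)) (t₀ r : ℝ), t₀ ≤ 0 → 0 < r →
        (∀ t, t₀ - r ^ 2 < t → t < t₀ → r⁻¹ * ∫ x in Metric.ball x₀ r, ‖u t x‖ ^ 2 ≤ C) ∧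
          r⁻¹ * ∫ t in Set.Ioo (t₀ - r ^ 2) t₀, ∫ x in Metric.ball x₀ r, ‖fderiv ℝ (u t) x‖ ^ 2 ≤ C) ∧
      (∀ r > 0, ∀ M : ℝ, ∃ t ∈ Set.Ioo (-(r ^ 2)) (0 : ℝ),
        ∃ x ∈ Metric.ball (0 : EuclideanSpace ℝ (Fin 3)) r, M < ‖u t x‖) ∧
      (-(-1 : ℝ)) ^ ((3 : ℝ) / 2) *
        ∫ x, ‖timeDeriv u (-1) x‖ ^ 2 * Real.exp (-(‖x‖ ^ 2) / (4 * (-(-1 : ℝ)))) <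
          1 / ((n : ℝ) + 1) := fun n => by
    obtain ⟨u, hu, hE, hsing, hlt⟩ := h _ Nat.one_div_pos_of_nat
    exact ⟨u, hu, hE, hsing, hlt⟩
  choose u hu hE hsing hlt using hseq
  have hC : 0 ≤ C := (hu 0).nonneg
  obtain ⟨-, -, hconv, -⟩ := stub_clockSlice stub_timeDerivBounds
  -- compactness on the growing windows `(-(k+1), 0)`
  set A : ℕ → ℝ := fun k => -((k : ℝ) + 1) with hA
  have hAt : Tendsto A atTop atBot :=
    tendsto_neg_atTop_atBot.comp (tendsto_natCast_atTop_atTop.atTop_add tendsto_const_nhds)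
  have hcont : ∀ k, ContinuousOn (uncurry (u k)) (Ioo (A k) 0 ×ˢ univ) := fun k =>
    (hu k).continuousOn_uncurry.mono (prod_mono (fun t ht => ht.2) subset_rfl)
  have hdivw : ∀ k, ∀ t ∈ Ioo (A k) 0, IsWeaklyDivFree (u k t) := fun k t ht =>
    (hu k).isWeaklyDivFree ht.2
  have hmild : ∀ k, ∀ s t : ℝ, A k < s → s < t → t < 0 → ∀ x,
      u k t x = UnboundedOperators.heatExtension (u k s) (t - s) x -
        oseenDuhamel 1 s (u k) (u k) t x :=
    fun k s t _ hst ht x => (hu k).mild_eq_heatExtension hst ht x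
  have hI : ∀ k, ∀ t ∈ Ioo (A k) 0, ∀ x, ‖u k t x‖ ≤ C / Real.sqrt (-t) := fun k t ht x =>
    (hu k).norm_le ht.2 x
  obtain ⟨φ, hφ, W, hW, hpt, hptG, -, -⟩ :=
    exists_tendsto_of_typeI_seq_Ioo C hAt hcont hdivw hmild hI
  -- the ledger passes to the limit
  have hAφ : Tendsto (fun j => A (φ j)) atTop atBot := hAt.comp hφ.tendsto_atTop
  have hEW := energyBounds_of_tendsto_Ioo C (B := C) hC hAφ (w := fun j => u (φ j))
    (fun j => hcont (φ j)) (fun j => hdivw (φ j)) (fun j => hmild (φ j)) (fun j => hI (φ j))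
    (fun x₀ t ht r hr => Eventually.of_forall fun j =>
      scaledEnergy_le_of_ledger (hE (φ j)) x₀ ht hr)
    (fun x₀ t₀ r ht₀ hr => Eventually.of_forall fun j => (hE (φ j) x₀ t₀ r ht₀.le hr).2)
    hW hpt hptG
  -- the limit is singular
  have hWsing := clockLaw_singular_of_limit (fun j => hu (φ j)) (fun j => hE (φ j))
    (fun j => hsing (φ j)) hpt
  -- the clocks at `-1` converge, to a limit `≤ 0`
  have hlimA := hconv C (fun j => u (φ j)) W (fun j => hu (φ j)) hW hpt (-1) (by norm_num)
  have hb : Tendsto (fun j : ℕ => 1 / ((φ j : ℝ) + 1)) atTop (𝓝 0) :=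
    (tendsto_one_div_add_atTop_nhds_zero_nat (𝕜 := ℝ)).comp hφ.tendsto_atTop
  have hle : (-(-1 : ℝ)) ^ ((3 : ℝ) / 2) *
      ∫ x, ‖timeDeriv W (-1) x‖ ^ 2 * Real.exp (-(‖x‖ ^ 2) / (4 * (-(-1 : ℝ)))) ≤ 0 :=
    le_of_tendsto_of_tendsto' hlimA hb fun j => (hlt (φ j)).le
  -- but the clock of a singular element is positive
  exact absurd (clockLaw_amp_pos hW hWsing (by norm_num : (-1 : ℝ) < 0)) (not_lt.2 hle)

/-! ### The class-uniform, all-time clock law -/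

/-- **Stub `stub_uniformClockLaw` (portrait clause of crux `ClockCeiling`, line `registered`): THE
CLASS-UNIFORM, ALL-TIME CLOCK LAW.** For every `C` there is `δ = δ(C) > 0` such that every element `u`
of the route's Type-I model class `𝒦_C` that is singular at the space-time origin satisfies
`a_u(t) = (−t)^{3/2} ∫ ‖∂ₜu(t,x)‖² e^{−‖x‖²/(4(−t))} dx ≥ δ` for EVERY `t < 0`. (The uniform floor at
`t = −1`, `clockLaw_uniform_at_neg_one`, transported to any `t < 0` by the zoom with `c = √(−t)`:
`u_c ∈ 𝒦_C` is singular, `clockLaw_singular_zoom`, with the same ledger,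
`limitSingular_energyLedger_zoom`, and `a_{u_c}(−1) = a_u(t)`, `stub_clockSlice` (iv).) Since by the
line's certificates `¬ClockCeiling ↔` "a singular element exists", this is a portrait of any
counterexample: its Leray profile keeps `‖ΔU − U·∇U − ∇P‖_{L²_ρ} ≥ √δ(C)` at every similarity time.
[cite: AlbrittonBarker2019, Lemma 2.2 and Prop. 2.3] [cite: KochNadirashviliSereginSverak2009, Lemma 6.1 and Prop. 4.1 (arXiv:0709.3599 pp. 8, 11)] -/
theorem stub_uniformClockLaw :
    ∀ C : ℝ, ∃ δ > 0, ∀ u : ℝ → EuclideanSpace ℝ (Fin 3) → EuclideanSpace ℝ (Fin 3), ContDiffOn ℝ (⊤ : ℕ∞) (Function.uncurry u) (Set.Iio 0 ×ˢ Set.univ) ∧ (∀ t < 0, Literature.Analysis.FluidPDE.VectorCalculus.IsDivFree (u t)) ∧ (∀ s t : ℝ, s < t → t < 0 → ∀ x, u t x = Literature.Analysis.FluidPDE.heatFlow (u s) (t - s) x - ∫ τ in Set.Ioo s t, ∫ y, ((-(inner ℝ (x - y) (u τ y) / (2 * (t - τ)) * Literature.Analysis.UnboundedOperators.heatKernel (t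 - τ) (x - y))) • u τ y + (∫ σ in Set.Ioi (t - τ), Literature.Analysis.UnboundedOperators.heatKernel σ (x - y) / (4 * σ ^ 2)) • (inner ℝ (x - y) (u τ y) • u τ y + inner ℝ (u τ y) (u τ y) • (x - y) + inner ℝ (x - y) (u τ y) • u τ y) - ((∫ σ in Set.Ioi (t - τ), Literature.Analysis.UnboundedOperators.heatKernel σ (x - y) / (8 * σ ^ 3)) * (inner ℝ (x - y) (u τ y) * inner ℝ (x - y) (u τ y))) • (x - y))) ∧ Literature.Analysis.FluidPDE.HasTypeITimeDecay C u ∧ (∀ (x₀ : EuclideanSpace ℝ (Fin 3)) (t₀ r : ℝ), t₀ ≤ 0 → 0 < r → (∀ t, t₀ - r ^ 2 < t → t < t₀ → r⁻¹ * ∫ x in Metric.ball x₀ r, ‖u t x‖ ^ 2 ≤ C) ∧ r⁻¹ * ∫ t in Set.Ioo (t₀ - r ^ 2) t₀, ∫ x in Metric.ball x₀ r, ‖fderiv ℝ (u t) x‖ ^ 2 ≤ C) → (∀ r > 0, ∀ M : ℝ, ∃ t ∈ Set.Ioo (-(r ^ 2)) (0 : ℝ), ∃ x ∈ Metric.ball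 (0 : EuclideanSpace ℝ (Fin 3)) r, M < ‖u t x‖) → ∀ t : ℝ, t < 0 → δ ≤ (-t) ^ ((3 : ℝ) / 2) * ∫ x, ‖Literature.Analysis.FluidPDE.timeDeriv u t x‖ ^ 2 * Real.exp (-(‖x‖ ^ 2) / (4 * (-t))) := by
  intro C
  obtain ⟨δ, hδ, hδ1⟩ := clockLaw_uniform_at_neg_one C
  refine ⟨δ, hδ, fun u hu hsing t ht => ?_⟩
  obtain ⟨h1, h2, h3, h4, hE⟩ := hu
  have hu' : IsTypeIAncientMild C u := clockLaw_isTypeIAncientMild_of_inline h1 h2 h3 h4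
  obtain ⟨-, -, -, hcov⟩ := stub_clockSlice stub_timeDerivBounds
  -- the zoom with `c = √(-t)`
  set c : ℝ := Real.sqrt (-t) with hc
  have hcpos : 0 < c := Real.sqrt_pos.2 (neg_pos.2 ht)
  have hcsq : c ^ 2 = -t := Real.sq_sqrt (neg_nonneg.2 ht.le)
  have key := hδ1 (c • stPull (c ^ 2) c 0 0 u) (isTypeIAncientMild_zoom hu' hcpos 0)
    (limitSingular_energyLedger_zoom hu' hE hcpos) (clockLaw_singular_zoom hsing hcpos)
  rw [hcov C u hu' c hcpos (-1) (by norm_num)] at key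
  have e : c ^ 2 * (-1 : ℝ) = t := by rw [hcsq]; ring
  rw [e] at key
  exact key

end Summit.NavierStokesRegularity.NavierStokesRegularity.Theorems

end
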